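import Mathlib
import Literature.Analysis.FluidPDE.GaussianVortexPlanar
import Literature.Analysis.FluidPDE.GaussianVortexPlanarProofs
import Literature.Analysis.FluidPDE.BiotSavart2DSymmetry
import Literature.Analysis.FluidPDE.WholeSpaceIBP
import Summits.AnomalousDissipation.AnomalousDissipation.Theorems.MarginalStabilityChainStretchedVortexRowsStubCoreRotationLocalSkew
import Summits.AnomalousDissipation.AnomalousDissipation.Theorems.MarginalStabilityChainStretchedVortexRowsStubLamBPairingDtheta
import Summits.AnomalousDissipation.AnomalousDissipation.Theorems.MarginalStabilityChainStretchedVortexRowsStubCircAvgTools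
import Summits.AnomalousDissipation.AnomalousDissipation.Theorems.MarginalStabilityChainStretchedVortexRowsStubCircAvgPolar
import Summits.AnomalousDissipation.AnomalousDissipation.Theorems.MarginalStabilityChainStretchedVortexRowsStubCircAvgWirtinger
import Summits.AnomalousDissipation.AnomalousDissipation.Theorems.MarginalStabilityChainStretchedVortexRowsStubCoreInverseIntegrabilityClass
import Summits.AnomalousDissipation.AnomalousDissipation.Theorems.MarginalStabilityChainStretchedVortexRowsStubCoreInverseIntegrabilityTools
import Summits.AnomalousDissipation.AnomalousDissipation.Theorems.MarginalStabilityChainStretchedVortexRowsStubLamBTransportIdentity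
import Summits.AnomalousDissipation.AnomalousDissipation.Theorems.MarginalStabilityChainStretchedVortexRowsStubLamBRadialBlock
import Summits.AnomalousDissipation.AnomalousDissipation.Theorems.MarginalStabilityChainStretchedVortexRowsStubLamBPairingWBlocks
import Summits.AnomalousDissipation.AnomalousDissipation.Theorems.MarginalStabilityChainStretchedVortexRowsStubLamBPairingWPotential
import HarnessLib

/-!
# Helper `lamB_pairing_w_bound` toward stub `stub_coreInverse` of the line `braid-closed-large-circulation-gluing`
# (crux stmt-AnomalousDissipation-3009, `MarginalStabilityChain.StretchedVortexRows`)

**The background pairing against `w`** in the energy method for the cut-off core operator at the Gaussian vortex: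
for `w = G u` (`u ∈ C²` even, `u, Du, D²u` bounded), `G = (4π)⁻¹e^{−|ξ|²/4}`, and an even Gaussian-class background
`w_B` (`|w_B| + |∇w_B| ≤ C_B(1+|ξ|)^k G`), with `Λ_B w = (K∗w)·∇w_B + (K∗w_B)·∇w` (`K(z) = z^⊥/(2π|z|²)`),
  `|⟨Λ_B w, w⟩_{L²(G⁻¹)}| ≤ C₃(k, C_B) (∫G|Du|² + ∫Gu²)^{1/2} Θ^{1/2}`,  `Θ = ∫ G⁻¹Ω(∂_θw)²`, `Ω = (8π)⁻¹φ(|ξ|²/4)`.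
Unlike a direct Cauchy–Schwarz estimate, the factor `Θ^{1/2}` (the ANGULAR energy only) comes from the structure
of the pairing under the circular-mean decomposition `u = u₀ + (u − u₀)` (`u₀` = average of `u` over rotations):

* gradient half `T₁ = ∫ G⁻¹ w ⟪K∗w, ∇w_B⟫ = ∫ u ⟪K∗(Gu), ∇w_B⟫` (`lamB_w_gradient_piece`): by linearity of the
  Biot–Savart law, `T₁ = ∫u₀⟪K∗(Gu₀),∇w_B⟫ + ∫u₀⟪K∗(G(u−u₀)),∇w_B⟫ + ∫(u−u₀)⟪K∗(Gu),∇w_B⟫`; the radial↔radial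
  block vanishes (azimuthal velocity against radial gradients, landed `lamB_radial_block_eq_zero`), and the two other
  blocks are `≤ c (∫GΩa²)^{1/2}(∫GΩv²)^{1/2}` (landed generic block `lamB_w_gradient_block`: Young's inequality for
  `K ∈ L¹ + L^∞` in ground-state variables and Cauchy–Schwarz), where `∫GΩu₀² ≤ ∫GΩu² ≤ ∫Gu²` (circular means
  contract radial-weight `L²` norms) and `∫GΩ(u−u₀)² ≤ ¼∫GΩ(∂_θu)²` (Wirtinger on circles for even functions,
  `circAvg_wirtinger_even`);
* transport half `T₂ = ∫ G⁻¹ w ⟪K∗w_B, ∇w⟫ = −¼∫Gu²(ξ·K∗w_B)` (weak divergence-freeness, landed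
  `lamB_transport_pairing_identity`), a potential term bounded by `c (∫Gu²)^{1/2}(∫GΩ(∂_θu)²)^{1/2}` (landed
  `lamB_w_potential_piece`: the radial block `∫Gu₀²(ξ·K∗w_B)` vanishes — no flux through circles — and the rest
  carries a factor `u − u₀`);
* finally `∂_θw = G ∂_θu`, so `∫GΩ(∂_θu)² = Θ`, and `∫Gu² ≤ ∫G|Du|² + ∫Gu²`.

References: Th. Gallay, C. E. Wayne, Comm. Math. Phys. 255 (2005) §4.1 (radial/non-radial decomposition in
`L²(G⁻¹)`); Th. Gallay, Y. Maekawa, arXiv:1610.08384 §4.1; the estimates themselves are elementary (folklore).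
-/

set_option linter.dupNamespace false

noncomputable section

open scoped RealInnerProductSpace Topology ContDiff
open MeasureTheory WithLp Function Metric Filter Set

namespace Summit.AnomalousDissipation.AnomalousDissipation.Theorems.MarginalStabilityChainStretchedVortexRows

open Literature.Analysis.FluidPDE

/-- `g⁻¹ X (g v) = v X` for `g ≠ 0` (passage between `L²(G⁻¹)` pairings of `w = Gu` and flat pairings of `u`). [folklore] -/
theorem inv_mul_mul_mul_self_mul {g : ℝ} (hg : g ≠ 0) (X v : ℝ) : g⁻¹ * X * (g * v) = v * X := by
  calc g⁻¹ * X * (g * v) = g⁻¹ * g * (v * X) := by ring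
    _ = v * X := by rw [inv_mul_cancel₀ hg, one_mul]

/-- **The gradient half of `⟨Λ_B w, w⟩_{L²(G⁻¹)}`**: there is `c = c(k, C_B) ≥ 0` such that for `w_B ∈ C¹` with
`|w_B| + ‖∇w_B‖ ≤ C_B(1+|ξ|)^kG` and even `u ∈ C¹` with `u, Du` bounded, `u⟪K∗(Gu), ∇w_B⟫ ∈ L¹` and
`|∫ u ⟪K∗(Gu), ∇w_B⟫| ≤ c (∫Gu²)^{1/2} (∫GΩ(Du[ξ^⊥])²)^{1/2}` (circular-mean decomposition: the radial↔radial block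
vanishes, the two others are controlled by the generic block estimate, the `L²` contraction of circular means and
Wirtinger's inequality on circles). [folklore] -/
theorem lamB_w_gradient_piece (k : ℕ) (C_B : ℝ) :
    ∃ c : ℝ, 0 ≤ c ∧ ∀ (wB u : EuclideanSpace ℝ (Fin 2) → ℝ), ContDiff ℝ 1 wB →
      (∀ ξ, |wB ξ| + ‖gradient wB ξ‖ ≤ C_B * (1 + ‖ξ‖) ^ k * gaussVortexProfile ξ) →
      ContDiff ℝ 1 u → (∀ ξ, u (-ξ) = u ξ) → (∃ M : ℝ, ∀ ξ, |u ξ| ≤ M ∧ ‖fderiv ℝ u ξ‖ ≤ M) →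
      Integrable (fun ξ => u ξ * ⟪biotSavart2D (fun η => gaussVortexProfile η * u η) ξ, gradient wB ξ⟫) ∧
        |∫ ξ, u ξ * ⟪biotSavart2D (fun η => gaussVortexProfile η * u η) ξ, gradient wB ξ⟫| ≤
          c * Real.sqrt (∫ ξ, gaussVortexProfile ξ * u ξ ^ 2) *
            Real.sqrt (∫ ξ, gaussVortexProfile ξ * ((8 * Real.pi)⁻¹ * burgersPhi (‖ξ‖ ^ 2 / 4)) *
              (fderiv ℝ u ξ (perp ξ)) ^ 2) := by
  obtain ⟨c, hc0, hc⟩ := lamB_w_gradient_block k C_B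
  refine ⟨2 * c, by positivity, ?_⟩
  rintro wB u hwB hwBbd hu heven ⟨M, hM⟩
  have hGpos : ∀ ξ : EuclideanSpace ℝ (Fin 2), 0 < gaussVortexProfile ξ := gaussVortexProfile_pos
  have hGc : Continuous gaussVortexProfile := (contDiff_gaussVortexProfile (n := 0)).continuous
  have hΩc : Continuous fun ξ : EuclideanSpace ℝ (Fin 2) => (8 * Real.pi)⁻¹ * burgersPhi (‖ξ‖ ^ 2 / 4) :=
    continuous_const.mul ((contDiff_burgersPhi (n := 0)).continuous.comp ((continuous_norm.pow 2).div_const 4))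
  have hΩ0 : ∀ ξ : EuclideanSpace ℝ (Fin 2), 0 < (8 * Real.pi)⁻¹ * burgersPhi (‖ξ‖ ^ 2 / 4) := fun ξ =>
    mul_pos (by positivity) (burgersPhi_pos _)
  have hΩ1 : ∀ ξ : EuclideanSpace ℝ (Fin 2), (8 * Real.pi)⁻¹ * burgersPhi (‖ξ‖ ^ 2 / 4) ≤ (8 * Real.pi)⁻¹ :=
    fun ξ => mul_le_of_le_one_right (by positivity) (burgersPhi_le_one (by positivity))
  have hM0 : 0 ≤ M := (abs_nonneg _).trans (hM 0).1
  have huc : Continuous u := hu.continuous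
  have hgwBc : Continuous (gradient wB) := continuous_gradient_of_contDiff hwB
  have hwBg : ∀ ξ, ‖gradient wB ξ‖ ≤ C_B * (1 + ‖ξ‖) ^ k * gaussVortexProfile ξ := fun ξ =>
    (le_add_of_nonneg_left (abs_nonneg _)).trans (hwBbd ξ)
  -- the circular mean `u₀` of `u`: radial, `C¹`, with the bounds of `u`
  set u₀ : EuclideanSpace ℝ (Fin 2) → ℝ := fun ξ => (2 * Real.pi)⁻¹ * ∫ t in (0:ℝ)..2 * Real.pi,
    u (Real.cos t • ξ + Real.sin t • perp ξ) with hu₀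
  have hu₀c : Continuous u₀ := continuous_circularMean hu₀ huc
  have hu₀1 : ContDiff ℝ 1 u₀ := contDiff_circularMean hu₀ (n := 1) hu
  have hu₀rad : ∀ ξ η : EuclideanSpace ℝ (Fin 2), ‖ξ‖ = ‖η‖ → u₀ ξ = u₀ η := circularMean_radial hu₀
  have hu₀b : ∀ ξ, |u₀ ξ| ≤ M := abs_circularMean_le hu₀ fun ξ => (hM ξ).1
  have hu₀d : ∀ ξ, ‖fderiv ℝ u₀ ξ‖ ≤ M := norm_fderiv_circularMean_le hu₀ hu one_ne_zero fun ξ => (hM ξ).2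
  have hupb : ∀ ξ, |u ξ - u₀ ξ| ≤ 2 * M := fun ξ =>
    (abs_sub _ _).trans (by linarith [(hM ξ).1, hu₀b ξ])
  -- the three blocks of `∫ u ⟪K∗(Gu), ∇w_B⟫`
  obtain ⟨hi₁, -⟩ := hc wB u₀ u₀ hgwBc hwBg hu₀c hu₀c ⟨M, fun ξ => ⟨hu₀b ξ, hu₀b ξ⟩⟩
  obtain ⟨hi₂, hb₂⟩ := hc wB u₀ (fun ξ => u ξ - u₀ ξ) hgwBc hwBg hu₀c (huc.sub hu₀c)
    ⟨2 * M, fun ξ => ⟨(hu₀b ξ).trans (by linarith), hupb ξ⟩⟩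
  obtain ⟨hi₃, hb₃⟩ := hc wB (fun ξ => u ξ - u₀ ξ) u hgwBc hwBg (huc.sub hu₀c) huc
    ⟨2 * M, fun ξ => ⟨hupb ξ, (hM ξ).1.trans (by linarith)⟩⟩
  -- the radial↔radial block vanishes
  have hzero : ∫ ξ, u₀ ξ * ⟪biotSavart2D (fun η => gaussVortexProfile η * u₀ η) ξ, gradient wB ξ⟫ = 0 :=
    lamB_radial_block_eq_zero k C_B wB u₀ hwB hwBbd hu₀1 hu₀rad ⟨M, fun ξ => ⟨hu₀b ξ, hu₀d ξ⟩⟩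
  -- linearity of the Biot–Savart law: `K∗(Gu) = K∗(Gu₀) + K∗(G(u − u₀))`
  have hGv : ∀ (v : EuclideanSpace ℝ (Fin 2) → ℝ) (A : ℝ), Continuous v → (∀ ξ, |v ξ| ≤ A) →
      Integrable (fun η => gaussVortexProfile η * v η) ∧ ∀ η, |gaussVortexProfile η * v η| ≤ (4 * Real.pi)⁻¹ * A := by
    intro v A hv hA
    have hA0 : 0 ≤ A := (abs_nonneg _).trans (hA 0)
    refine ⟨integrable_of_le_one_add_norm_pow_mul_gauss (hGc.mul hv) (A := A) (N := 0) fun η => ?_, fun η => ?_⟩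
    · rw [Real.norm_eq_abs, abs_mul, abs_of_pos (hGpos η), pow_zero, one_mul, mul_comm]
      exact mul_le_mul_of_nonneg_right (hA η) (hGpos η).le
    · rw [abs_mul, abs_of_pos (hGpos η)]
      exact mul_le_mul (gaussVortexProfile_le η) (hA η) (abs_nonneg _) (by positivity)
  obtain ⟨hw₀i, hw₀b⟩ := hGv u₀ M hu₀c hu₀b
  obtain ⟨hwpi, hwpb⟩ := hGv (fun ξ => u ξ - u₀ ξ) (2 * M) (huc.sub hu₀c) hupb
  have hlin : ∀ ξ, biotSavart2D (fun η => gaussVortexProfile η * u η) ξ =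
      biotSavart2D (fun η => gaussVortexProfile η * u₀ η) ξ +
        biotSavart2D (fun η => gaussVortexProfile η * (u η - u₀ η)) ξ := by
    intro ξ
    have e : (fun y => (gaussVortexProfile y * u y) • biotSavartKernel2D (ξ - y)) = fun y =>
        (gaussVortexProfile y * u₀ y) • biotSavartKernel2D (ξ - y) +
          (gaussVortexProfile y * (u y - u₀ y)) • biotSavartKernel2D (ξ - y) := by
      funext y
      rw [← add_smul]
      congr 1
      ring
    simp only [biotSavart2D]
    rw [e]
    exact integral_add (integrable_smul_biotSavartKernel2D hw₀i hw₀b ξ) (integrable_smul_biotSavartKernel2D hwpi hwpb ξ)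
  have hpt : ∀ ξ, u ξ * ⟪biotSavart2D (fun η => gaussVortexProfile η * u η) ξ, gradient wB ξ⟫ =
      u₀ ξ * ⟪biotSavart2D (fun η => gaussVortexProfile η * u₀ η) ξ, gradient wB ξ⟫ +
        u₀ ξ * ⟪biotSavart2D (fun η => gaussVortexProfile η * (u η - u₀ η)) ξ, gradient wB ξ⟫ +
        (u ξ - u₀ ξ) * ⟪biotSavart2D (fun η => gaussVortexProfile η * u η) ξ, gradient wB ξ⟫ := by
    intro ξ
    rw [hlin ξ, inner_add_left]
    ring
  have hint : Integrable (fun ξ => u ξ * ⟪biotSavart2D (fun η => gaussVortexProfile η * u η) ξ, gradient wB ξ⟫) :=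
    ((hi₁.fun_add hi₂).fun_add hi₃).congr (Eventually.of_forall fun ξ => (hpt ξ).symm)
  refine ⟨hint, ?_⟩
  have hsplit : ∫ ξ, u ξ * ⟪biotSavart2D (fun η => gaussVortexProfile η * u η) ξ, gradient wB ξ⟫ =
      (∫ ξ, u₀ ξ * ⟪biotSavart2D (fun η => gaussVortexProfile η * (u η - u₀ η)) ξ, gradient wB ξ⟫) +
        ∫ ξ, (u ξ - u₀ ξ) * ⟪biotSavart2D (fun η => gaussVortexProfile η * u η) ξ, gradient wB ξ⟫ := by
    rw [integral_congr_ae (Eventually.of_forall hpt), integral_add (hi₁.fun_add hi₂) hi₃, integral_add hi₁ hi₂,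
      hzero, zero_add]
  -- the Gaussian `L²` quantities
  have hN0 : 0 ≤ ∫ ξ, gaussVortexProfile ξ * u ξ ^ 2 := integral_nonneg fun ξ => mul_nonneg (hGpos ξ).le (sq_nonneg _)
  have hNi : Integrable fun ξ => gaussVortexProfile ξ * u ξ ^ 2 := by
    refine integrable_of_le_one_add_norm_pow_mul_gauss (hGc.mul (huc.pow 2)) (A := M ^ 2) (N := 0) fun ξ => ?_
    rw [Real.norm_of_nonneg (mul_nonneg (hGpos ξ).le (sq_nonneg _)), pow_zero, one_mul, mul_comm]
    have hu2 : u ξ ^ 2 ≤ M ^ 2 := by rw [← sq_abs]; exact pow_le_pow_left₀ (abs_nonneg _) (hM ξ).1 2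
    exact mul_le_mul_of_nonneg_right hu2 (hGpos ξ).le
  have hρle : ∀ ξ, gaussVortexProfile ξ * ((8 * Real.pi)⁻¹ * burgersPhi (‖ξ‖ ^ 2 / 4)) * u ξ ^ 2 ≤
      (8 * Real.pi)⁻¹ * (gaussVortexProfile ξ * u ξ ^ 2) := fun ξ =>
    calc gaussVortexProfile ξ * ((8 * Real.pi)⁻¹ * burgersPhi (‖ξ‖ ^ 2 / 4)) * u ξ ^ 2
        ≤ gaussVortexProfile ξ * (8 * Real.pi)⁻¹ * u ξ ^ 2 :=
          mul_le_mul_of_nonneg_right (mul_le_mul_of_nonneg_left (hΩ1 ξ) (hGpos ξ).le) (sq_nonneg _)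
      _ = (8 * Real.pi)⁻¹ * (gaussVortexProfile ξ * u ξ ^ 2) := by ring
  have hρi : Integrable fun ξ => gaussVortexProfile ξ * ((8 * Real.pi)⁻¹ * burgersPhi (‖ξ‖ ^ 2 / 4)) * u ξ ^ 2 :=
    (hNi.const_mul (8 * Real.pi)⁻¹).mono' ((hGc.mul hΩc).mul (huc.pow 2)).aestronglyMeasurable
      (Eventually.of_forall fun ξ => by
        rw [Real.norm_of_nonneg (mul_nonneg (mul_nonneg (hGpos ξ).le (hΩ0 ξ).le) (sq_nonneg _))]
        exact hρle ξ)
  have hΩNle : ∫ ξ, gaussVortexProfile ξ * ((8 * Real.pi)⁻¹ * burgersPhi (‖ξ‖ ^ 2 / 4)) * u ξ ^ 2 ≤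
      ∫ ξ, gaussVortexProfile ξ * u ξ ^ 2 := by
    have h8 : (8 * Real.pi)⁻¹ ≤ 1 := inv_le_one_of_one_le₀ (by nlinarith [Real.pi_gt_three])
    calc ∫ ξ, gaussVortexProfile ξ * ((8 * Real.pi)⁻¹ * burgersPhi (‖ξ‖ ^ 2 / 4)) * u ξ ^ 2
        ≤ ∫ ξ, (8 * Real.pi)⁻¹ * (gaussVortexProfile ξ * u ξ ^ 2) := integral_mono hρi (hNi.const_mul _) hρle
      _ = (8 * Real.pi)⁻¹ * ∫ ξ, gaussVortexProfile ξ * u ξ ^ 2 := integral_const_mul _ _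
      _ ≤ ∫ ξ, gaussVortexProfile ξ * u ξ ^ 2 := mul_le_of_le_one_left hN0 h8
  obtain ⟨-, hΩN₀le⟩ := integral_mul_circularMean_sq_le hu₀ huc
    (ρ := fun ξ => gaussVortexProfile ξ * ((8 * Real.pi)⁻¹ * burgersPhi (‖ξ‖ ^ 2 / 4))) (hGc.mul hΩc)
    (fun ξ => mul_nonneg (hGpos ξ).le (hΩ0 ξ).le) (fun ξ η h => by simp only [gaussVortexProfile, h]) hρi
  -- the angular quantity: Wirtinger on circles for the even function `u`
  have hW : ∫ ξ, gaussVortexProfile ξ * ((8 * Real.pi)⁻¹ * burgersPhi (‖ξ‖ ^ 2 / 4)) * (u ξ - u₀ ξ) ^ 2 ≤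
      1 / 4 * ∫ ξ, gaussVortexProfile ξ * ((8 * Real.pi)⁻¹ * burgersPhi (‖ξ‖ ^ 2 / 4)) *
        (fderiv ℝ u ξ (perp ξ)) ^ 2 := circAvg_wirtinger_even u hu heven ⟨M, hM⟩
  have hA0 : 0 ≤ ∫ ξ, gaussVortexProfile ξ * ((8 * Real.pi)⁻¹ * burgersPhi (‖ξ‖ ^ 2 / 4)) *
      (fderiv ℝ u ξ (perp ξ)) ^ 2 :=
    integral_nonneg fun ξ => mul_nonneg (mul_nonneg (hGpos ξ).le (hΩ0 ξ).le) (sq_nonneg _)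
  have hsq1 : Real.sqrt (∫ ξ, gaussVortexProfile ξ * ((8 * Real.pi)⁻¹ * burgersPhi (‖ξ‖ ^ 2 / 4)) * u₀ ξ ^ 2) ≤
      Real.sqrt (∫ ξ, gaussVortexProfile ξ * u ξ ^ 2) := Real.sqrt_le_sqrt (hΩN₀le.trans hΩNle)
  have hsq2 : Real.sqrt (∫ ξ, gaussVortexProfile ξ * ((8 * Real.pi)⁻¹ * burgersPhi (‖ξ‖ ^ 2 / 4)) * u ξ ^ 2) ≤
      Real.sqrt (∫ ξ, gaussVortexProfile ξ * u ξ ^ 2) := Real.sqrt_le_sqrt hΩNle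
  have hsq3 : Real.sqrt (∫ ξ, gaussVortexProfile ξ * ((8 * Real.pi)⁻¹ * burgersPhi (‖ξ‖ ^ 2 / 4)) *
        (u ξ - u₀ ξ) ^ 2) ≤
      Real.sqrt (∫ ξ, gaussVortexProfile ξ * ((8 * Real.pi)⁻¹ * burgersPhi (‖ξ‖ ^ 2 / 4)) *
        (fderiv ℝ u ξ (perp ξ)) ^ 2) := Real.sqrt_le_sqrt (hW.trans (by linarith))
  have e₂ := hb₂.trans (mul_le_mul (mul_le_mul_of_nonneg_left hsq1 hc0) hsq3 (Real.sqrt_nonneg _) (by positivity))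
  have e₃ := hb₃.trans (mul_le_mul (mul_le_mul_of_nonneg_left hsq3 hc0) hsq2 (Real.sqrt_nonneg _) (by positivity))
  rw [hsplit]
  refine (abs_add_le _ _).trans ?_
  nlinarith [e₂, e₃]

/-- W4-J (H10a, background pairing against `w`; uses the EVENNESS of `w_B` and `w` through the circular-mean
decomposition — the radial↔radial block vanishes): `|⟨Λ_B w, w⟩_{L²(G⁻¹)}| ≤ C₃ (∫G|∇u|² + ∫Gu²)^{1/2} Θ^{1/2}`. -/
theorem lamB_pairing_w_bound :
    ∀ (k : ℕ) (C_B : ℝ), ∃ C₃ : ℝ, 0 < C₃ ∧ ∀ (wB u : EuclideanSpace ℝ (Fin 2) → ℝ),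
      ContDiff ℝ 2 wB → (∀ ξ, wB (-ξ) = wB ξ) →
      (∀ ξ, |wB ξ| + ‖gradient wB ξ‖ ≤ C_B * (1 + ‖ξ‖) ^ k * gaussVortexProfile ξ) →
      ContDiff ℝ 2 u → (∀ ξ, u (-ξ) = u ξ) →
      (∃ M : ℝ, ∀ ξ, |u ξ| ≤ M ∧ ‖fderiv ℝ u ξ‖ ≤ M ∧ ‖fderiv ℝ (fderiv ℝ u) ξ‖ ≤ M) →
      let w : EuclideanSpace ℝ (Fin 2) → ℝ := fun η => gaussVortexProfile η * u η
      |∫ ξ, (gaussVortexProfile ξ)⁻¹ *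
          (⟪biotSavart2D w ξ, gradient wB ξ⟫ + ⟪biotSavart2D wB ξ, gradient w ξ⟫) * w ξ| ≤
        C₃ * Real.sqrt ((∫ ξ, gaussVortexProfile ξ * ‖fderiv ℝ u ξ‖ ^ 2) +
            ∫ ξ, gaussVortexProfile ξ * u ξ ^ 2) *
          Real.sqrt (∫ ξ, (gaussVortexProfile ξ)⁻¹ * ((8 * Real.pi)⁻¹ * burgersPhi (‖ξ‖ ^ 2 / 4)) *
            (fderiv ℝ w ξ (perp ξ)) ^ 2) := by
  intro k C_B
  obtain ⟨c₁, hc₁, h₁⟩ := lamB_w_gradient_piece k C_B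
  obtain ⟨c₂, hc₂, h₂⟩ := lamB_w_potential_piece k C_B
  refine ⟨c₁ + c₂ + 1, by positivity, ?_⟩
  intro wB u hwB _ hwBbd hu heven hM w
  obtain ⟨M, hM⟩ := hM
  have hGpos : ∀ ξ : EuclideanSpace ℝ (Fin 2), 0 < gaussVortexProfile ξ := gaussVortexProfile_pos
  have hΩ0 : ∀ ξ : EuclideanSpace ℝ (Fin 2), 0 < (8 * Real.pi)⁻¹ * burgersPhi (‖ξ‖ ^ 2 / 4) := fun ξ =>
    mul_pos (by positivity) (burgersPhi_pos _)
  have hwB1 : ContDiff ℝ 1 wB := hwB.of_le one_le_two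
  have hu1 : ContDiff ℝ 1 u := hu.of_le one_le_two
  have hud : Differentiable ℝ u := hu1.differentiable one_ne_zero
  have hw1 : ContDiff ℝ 1 w := (contDiff_gaussVortexProfile (n := 1)).mul hu1
  have hwB0 : ∀ η, |wB η| ≤ C_B * (1 + ‖η‖) ^ k * gaussVortexProfile η := fun η =>
    (le_add_of_nonneg_right (norm_nonneg _)).trans (hwBbd η)
  have hM2 : ∀ ξ, |u ξ| ≤ M ∧ ‖fderiv ℝ u ξ‖ ≤ M := fun ξ => ⟨(hM ξ).1, (hM ξ).2.1⟩
  -- the gradient half `T₁`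
  obtain ⟨hi₁, hb₁⟩ := h₁ wB u hwB1 hwBbd hu1 heven ⟨M, hM2⟩
  have hi₁' : Integrable fun ξ => (gaussVortexProfile ξ)⁻¹ * ⟪biotSavart2D w ξ, gradient wB ξ⟫ * w ξ :=
    hi₁.congr (Eventually.of_forall fun ξ => (inv_mul_mul_mul_self_mul (hGpos ξ).ne' _ _).symm)
  have heq₁ : ∫ ξ, (gaussVortexProfile ξ)⁻¹ * ⟪biotSavart2D w ξ, gradient wB ξ⟫ * w ξ =
      ∫ ξ, u ξ * ⟪biotSavart2D (fun η => gaussVortexProfile η * u η) ξ, gradient wB ξ⟫ :=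
    integral_congr_ae (Eventually.of_forall fun ξ => inv_mul_mul_mul_self_mul (hGpos ξ).ne' _ _)
  -- the transport half `T₂`
  have hT2 : ∫ ξ, (gaussVortexProfile ξ)⁻¹ * ⟪biotSavart2D wB ξ, gradient w ξ⟫ * w ξ =
      -(1 / 4) * ∫ ξ, gaussVortexProfile ξ * u ξ ^ 2 * ⟪ξ, biotSavart2D wB ξ⟫ :=
    lamB_transport_pairing_identity k C_B wB u hwB.continuous hwB0 hu1 ⟨M, hM2⟩
  have hb₂ := h₂ wB u hwB.continuous hwB0 hu1 heven ⟨M, hM2⟩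
  obtain ⟨KB, hKB⟩ := exists_norm_biotSavart2D_le_of_gaussClass hwB.continuous hwB0
  have hi₂ : Integrable fun ξ => (gaussVortexProfile ξ)⁻¹ * ⟪biotSavart2D wB ξ, gradient w ξ⟫ * w ξ :=
    integrable_invGauss_mul_mul
      ((aestronglyMeasurable_biotSavart2D hwB.continuous).inner
        (continuous_gradient_of_contDiff hw1).aestronglyMeasurable)
      hw1.continuous.aestronglyMeasurable
      (gaussClass_inner_left hKB (norm_gradient_gauss_mul_le_of_coreBound hM hud))
      (abs_gauss_mul_le_of_coreBound hM)
  -- `Θ` in ground-state variables: `∂_θw = G ∂_θu`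
  have hΘ : ∫ ξ, (gaussVortexProfile ξ)⁻¹ * ((8 * Real.pi)⁻¹ * burgersPhi (‖ξ‖ ^ 2 / 4)) *
        (fderiv ℝ w ξ (perp ξ)) ^ 2 =
      ∫ ξ, gaussVortexProfile ξ * ((8 * Real.pi)⁻¹ * burgersPhi (‖ξ‖ ^ 2 / 4)) * (fderiv ℝ u ξ (perp ξ)) ^ 2 :=
    integral_congr_ae (Eventually.of_forall fun ξ => by
      show (gaussVortexProfile ξ)⁻¹ * ((8 * Real.pi)⁻¹ * burgersPhi (‖ξ‖ ^ 2 / 4)) *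
          (fderiv ℝ (fun η => gaussVortexProfile η * u η) ξ (perp ξ)) ^ 2 = _
      rw [fderiv_gauss_mul_perp hud]
      calc (gaussVortexProfile ξ)⁻¹ * ((8 * Real.pi)⁻¹ * burgersPhi (‖ξ‖ ^ 2 / 4)) *
            (gaussVortexProfile ξ * fderiv ℝ u ξ (perp ξ)) ^ 2
          = (gaussVortexProfile ξ)⁻¹ * gaussVortexProfile ξ * (gaussVortexProfile ξ *
              ((8 * Real.pi)⁻¹ * burgersPhi (‖ξ‖ ^ 2 / 4)) * (fderiv ℝ u ξ (perp ξ)) ^ 2) := by ring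
        _ = _ := by rw [inv_mul_cancel₀ (hGpos ξ).ne', one_mul])
  -- assemble
  have hsum : ∫ ξ, (gaussVortexProfile ξ)⁻¹ *
        (⟪biotSavart2D w ξ, gradient wB ξ⟫ + ⟪biotSavart2D wB ξ, gradient w ξ⟫) * w ξ =
      (∫ ξ, (gaussVortexProfile ξ)⁻¹ * ⟪biotSavart2D w ξ, gradient wB ξ⟫ * w ξ) +
        ∫ ξ, (gaussVortexProfile ξ)⁻¹ * ⟪biotSavart2D wB ξ, gradient w ξ⟫ * w ξ := by
    rw [← integral_add hi₁' hi₂]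
    exact integral_congr_ae (Eventually.of_forall fun ξ => by ring)
  have hN0 : 0 ≤ ∫ ξ, gaussVortexProfile ξ * u ξ ^ 2 := integral_nonneg fun ξ => mul_nonneg (hGpos ξ).le (sq_nonneg _)
  have hE0 : 0 ≤ ∫ ξ, gaussVortexProfile ξ * ‖fderiv ℝ u ξ‖ ^ 2 :=
    integral_nonneg fun ξ => mul_nonneg (hGpos ξ).le (sq_nonneg _)
  have hst : Real.sqrt (∫ ξ, gaussVortexProfile ξ * u ξ ^ 2) *
        Real.sqrt (∫ ξ, gaussVortexProfile ξ * ((8 * Real.pi)⁻¹ * burgersPhi (‖ξ‖ ^ 2 / 4)) *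
          (fderiv ℝ u ξ (perp ξ)) ^ 2) ≤
      Real.sqrt ((∫ ξ, gaussVortexProfile ξ * ‖fderiv ℝ u ξ‖ ^ 2) + ∫ ξ, gaussVortexProfile ξ * u ξ ^ 2) *
        Real.sqrt (∫ ξ, gaussVortexProfile ξ * ((8 * Real.pi)⁻¹ * burgersPhi (‖ξ‖ ^ 2 / 4)) *
          (fderiv ℝ u ξ (perp ξ)) ^ 2) :=
    mul_le_mul_of_nonneg_right (Real.sqrt_le_sqrt (le_add_of_nonneg_left hE0)) (Real.sqrt_nonneg _)
  rw [hsum, heq₁, hT2, hΘ]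
  refine (abs_add_le _ _).trans ?_
  rw [abs_mul, abs_neg, abs_of_pos (by norm_num : (0:ℝ) < 1 / 4)]
  nlinarith [hb₁, hb₂, hst, mul_nonneg hc₁ (sub_nonneg.2 hst), mul_nonneg hc₂ (sub_nonneg.2 hst),
    mul_nonneg (Real.sqrt_nonneg ((∫ ξ, gaussVortexProfile ξ * ‖fderiv ℝ u ξ‖ ^ 2) +
      ∫ ξ, gaussVortexProfile ξ * u ξ ^ 2))
      (Real.sqrt_nonneg (∫ ξ, gaussVortexProfile ξ * ((8 * Real.pi)⁻¹ * burgersPhi (‖ξ‖ ^ 2 / 4)) *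
        (fderiv ℝ u ξ (perp ξ)) ^ 2)),
    mul_nonneg (mul_nonneg hc₂ (Real.sqrt_nonneg (∫ ξ, gaussVortexProfile ξ * u ξ ^ 2)))
      (Real.sqrt_nonneg (∫ ξ, gaussVortexProfile ξ * ((8 * Real.pi)⁻¹ * burgersPhi (‖ξ‖ ^ 2 / 4)) *
        (fderiv ℝ u ξ (perp ξ)) ^ 2)),
    abs_nonneg (∫ ξ, gaussVortexProfile ξ * u ξ ^ 2 * ⟪ξ, biotSavart2D wB ξ⟫)]

end Summit.AnomalousDissipation.AnomalousDissipation.Theorems.MarginalStabilityChainStretchedVortexRows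

end
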